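import Summits.NavierStokesRegularity.FluidComputer.PalasekTowerLundgrenChildLaws
import Literature.Analysis.FluidPDE.LundgrenCrossSectionMoments

/-!
# REGISTER v2.3″ (continued): the swirl-speed FLOOR of a Lundgren-carried child core of arbitrary
# cross-section after the N-2′ budget — `U ≥ (Γ/8π)(λA_k/ρ)^{1/2}` — and its circulation capture

Cell `ns-blowup`, seat `ns-blowup-ecbridge-8` (g5); evidence toward the readout side of crux 19250
`HeredityFromTwo` (`stub_speed_floors`) of route `PalasekTowerBreakdown`. Companion of
`PalasekTowerLundgrenChildLaws` (same MODEL IDENTIFICATION «child core = cross-section of Lundgren's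
stretched flow in the host strain `c = λA_k` at `ν = 1`», same hypotheses), split off for the file-size
rule. It reads the Literature theorem `Lundgren.integral_curl_lundgren_const_swirl_floor_of_budget`
(ecbridge-8 g5: the angular virial identity `∫ω⟪K₂∗ω, x^⊥⟫ = Γ²/(4π)` — Newton, *The N-Vortex
Problem* §2.1, continuum form — through Saffman §13.3 (29) and MB Prop. 1.14 / §3.3) in register units.

* `palasekTowerBreakdown_childSwirl_floor_of_budget_anyProfile` — for a co-signed child
  (`ω_z(0, ·) ≥ 0`) with `Γ > 0`, tolerance `ρ > 1`, initial effective core fatter than `ρ/(λA_k)`: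
  once the run-up delivered `λA_k t ≥ log((s_eff(0)λA_k − 1)/(ρ − 1))`, every bound `U` of the child's
  swirl speed has **`U ≥ (Γ/8π)(λA_k/ρ)^{1/2}`** — the FLOOR companion of the ceiling
  `_childSwirl_le_sqrtStretch_anyProfile` (`≤ e^{ct/2}·2(BΓ/2π)^{1/2}`).
* `palasekTowerBreakdown_childCirculation_outside_le_of_budget_anyProfile` — after the budget, for
  every radius `r > 0` the child's axial circulation outside the disk of radius `r` about the axis is
  `≤ 4Γρ/(λA_k r²)` (Chebyshev with the co-sign and the compaction;
  `Lundgren.integral_indicator_curl_lundgren_const_le_of_budget`).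

WHAT THIS IS NOT: not NS about any registered flow — exact INFINITE-ENERGY Lundgren flows, no
registered stage; nothing is asserted about `ReadoutFloors`, `AprioriCeiling` or any crux; the
identification «child core = Lundgren cross-section» is a MODEL step.

References: P. K. Newton, *The N-Vortex Problem*, Springer AMS 145 (2001), §2.1
[cite: Newton2001NVortex, §2.1]; P. G. Saffman, *Vortex Dynamics*, CUP 1992, §13.3 (26)–(31), §3.10
(23), (28) [cite: Saffman1992, §13.3 eqs. (26)–(31)]; A. J. Majda, A. L. Bertozzi, CUP 2002, §1.7
Prop. 1.14, §3.3 [cite: MajdaBertozziCUP2002, §1.7 Prop. 1.14]; S. Palasek, arXiv:2605.13827, §3 (3.2)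
[cite: Palasek2026ElementaryModel, §3 (3.2)].
-/

namespace Summit.NavierStokesRegularity.FluidComputer.PalasekTowerClayBridge

open Real Set MeasureTheory
open Literature.Analysis.FluidPDE Literature.Analysis.FluidPDE.Lundgren

variable {S S' : Set ℝ}
  {v : ℝ → EuclideanSpace ℝ (Fin 2) → EuclideanSpace ℝ (Fin 2)}
  {q : ℝ → EuclideanSpace ℝ (Fin 2) → ℝ} {w : ℝ → EuclideanSpace ℝ (Fin 2) → ℝ}

/-- **THE CHILD'S SWIRL-SPEED FLOOR AFTER THE BUDGET, FOR ANY PROFILE** (`ν = 1`, host strain `λA_k`,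
tolerance `ρ > 1`; the setting of `_childPeak_floor_of_budget_anyProfile`): once the run-up has
delivered the N-2′ budget `λA_k t ≥ log((s_eff(0, z₀)λA_k − 1)/(ρ − 1))`, EVERY bound `U` of the
child's swirl speed, `‖e^{ct/2}ṽ(T(t), e^{ct/2}y)‖ ≤ U` for all `y` (`c = λA_k`), satisfies
**`(Γ/8π)·(λA_k/ρ)^{1/2} ≤ U`** — the Burgers swirl scale `Γ(λA_k)^{1/2}` up to `8πρ^{1/2}`,
whatever the profile: the angular virial identity `∫ω⟪K₂∗ω, x^⊥⟫ = Γ²/(4π)` gives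
`U ≥ Γ/(8π s_eff(t, z)^{1/2})` (`Lundgren.pow_three_integral_curl_lundgren_le_of_norm_swirl_le`; the
stretch cancels), and the compaction `s_eff(t, z) ≤ ρ/(λA_k)` does the rest
(`Lundgren.integral_curl_lundgren_const_swirl_floor_of_budget`). The FLOOR companion of
`_childSwirl_le_sqrtStretch_anyProfile`. -/
theorem palasekTowerBreakdown_childSwirl_floor_of_budget_anyProfile (R : TowerRates) (k : ℕ) {l : ℝ}
    (hl : 0 < l) (hS' : Convex ℝ S') (hv : IsClassicalNSSolutionOn S' 1 0 v q)
    (hω : HasUniformRapidDecayOn S' (fun σ η => PlanarEigenmode.vorticity (v σ) η))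
    (hBS : ∀ σ ∈ S', ∀ η, v σ η = biotSavart2D (PlanarEigenmode.vorticity (v σ)) η)
    (hw : IsSmoothSpaceTimeOn S' w)
    (hmaps : MapsTo (fun t => (exp (l * R.A k * t) - 1) / (l * R.A k)) S S') (h0 : (0 : ℝ) ∈ S)
    {t : ℝ} (ht : t ∈ S) (ht0 : 0 ≤ t) (z₀ z : ℝ)
    (hpos : ∀ x : EuclideanSpace ℝ (Fin 3), 0 ≤ curl (velocity (fun _ => l * R.A k)
          (fun t y => exp (l * R.A k * t / 2) •
            v ((exp (l * R.A k * t) - 1) / (l * R.A k)) (exp (l * R.A k * t / 2) • y))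
          (fun t y => exp (-(l * R.A k * t)) •
            w ((exp (l * R.A k * t) - 1) / (l * R.A k)) (exp (l * R.A k * t / 2) • y)) 0) x 2)
    (hΓ : 0 < ∫ y : EuclideanSpace ℝ (Fin 2),
        curl (velocity (fun _ => l * R.A k)
          (fun t y => exp (l * R.A k * t / 2) •
            v ((exp (l * R.A k * t) - 1) / (l * R.A k)) (exp (l * R.A k * t / 2) • y))
          (fun t y => exp (-(l * R.A k * t)) •
            w ((exp (l * R.A k * t) - 1) / (l * R.A k)) (exp (l * R.A k * t / 2) • y)) 0)
          (embedXY y + z₀ • eZ) 2)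
    {ρ : ℝ} (hρ : 1 < ρ)
    (hfat : ρ * (1 / (l * R.A k)) < (∫ y : EuclideanSpace ℝ (Fin 2), ‖y‖ ^ 2 *
        curl (velocity (fun _ => l * R.A k)
          (fun t y => exp (l * R.A k * t / 2) •
            v ((exp (l * R.A k * t) - 1) / (l * R.A k)) (exp (l * R.A k * t / 2) • y))
          (fun t y => exp (-(l * R.A k * t)) •
            w ((exp (l * R.A k * t) - 1) / (l * R.A k)) (exp (l * R.A k * t / 2) • y)) 0)
          (embedXY y + z₀ • eZ) 2) /
        (4 * ∫ y : EuclideanSpace ℝ (Fin 2),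
          curl (velocity (fun _ => l * R.A k)
          (fun t y => exp (l * R.A k * t / 2) •
            v ((exp (l * R.A k * t) - 1) / (l * R.A k)) (exp (l * R.A k * t / 2) • y))
          (fun t y => exp (-(l * R.A k * t)) •
            w ((exp (l * R.A k * t) - 1) / (l * R.A k)) (exp (l * R.A k * t / 2) • y)) 0)
          (embedXY y + z₀ • eZ) 2))
    (hbud : log (((∫ y : EuclideanSpace ℝ (Fin 2), ‖y‖ ^ 2 *
        curl (velocity (fun _ => l * R.A k)
          (fun t y => exp (l * R.A k * t / 2) •
            v ((exp (l * R.A k * t) - 1) / (l * R.A k)) (exp (l * R.A k * t / 2) • y))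
          (fun t y => exp (-(l * R.A k * t)) •
            w ((exp (l * R.A k * t) - 1) / (l * R.A k)) (exp (l * R.A k * t / 2) • y)) 0)
          (embedXY y + z₀ • eZ) 2) /
        (4 * ∫ y : EuclideanSpace ℝ (Fin 2),
          curl (velocity (fun _ => l * R.A k)
          (fun t y => exp (l * R.A k * t / 2) •
            v ((exp (l * R.A k * t) - 1) / (l * R.A k)) (exp (l * R.A k * t / 2) • y))
          (fun t y => exp (-(l * R.A k * t)) •
            w ((exp (l * R.A k * t) - 1) / (l * R.A k)) (exp (l * R.A k * t / 2) • y)) 0)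
          (embedXY y + z₀ • eZ) 2) * (l * R.A k) - 1) / (ρ - 1)) ≤ l * R.A k * t)
    {U : ℝ} (hU : ∀ y : EuclideanSpace ℝ (Fin 2), ‖exp (l * R.A k * t / 2) • v ((exp (l * R.A k * t) - 1) / (l * R.A k)) (exp (l * R.A k * t / 2) • y)‖ ≤ U) :
    (∫ y : EuclideanSpace ℝ (Fin 2),
        curl (velocity (fun _ => l * R.A k)
          (fun t y => exp (l * R.A k * t / 2) •
            v ((exp (l * R.A k * t) - 1) / (l * R.A k)) (exp (l * R.A k * t / 2) • y))
          (fun t y => exp (-(l * R.A k * t)) •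
            w ((exp (l * R.A k * t) - 1) / (l * R.A k)) (exp (l * R.A k * t / 2) • y)) 0)
          (embedXY y + z₀ • eZ) 2) / (8 * π) * Real.sqrt (l * R.A k / ρ) ≤ U := by
  have hγ : 0 < l * R.A k := mul_pos hl (R.A_pos k)
  have h := integral_curl_lundgren_const_swirl_floor_of_budget hγ one_pos hS' hv hω hBS hw hmaps h0 ht
    ht0 z₀ z hpos hΓ hρ hfat (by rw [div_div_eq_mul_div, div_one]; exact hbud) hU
  simpa only [mul_one] using h

/-- **CIRCULATION CAPTURE AFTER THE BUDGET, FOR ANY PROFILE** (`ν = 1`, host strain `λA_k`,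
tolerance `ρ > 1`; the setting of `_childPeak_floor_of_budget_anyProfile`): once the run-up has
delivered the N-2′ budget, for every radius `r > 0` and height `z` the child's axial circulation
OUTSIDE the disk of radius `r` about the axis is at most **`4Γρ/(λA_k r²)`** — e.g. the disk of radius
`(8ρ/λA_k)^{1/2}` captures at least half of `Γ`, whatever the profile (Chebyshev with `ω_z(t, ·) ≥ 0`
and the compaction `M(t, z) = 4Γ s_eff(t, z) ≤ 4Γρ/λA_k`;
`Lundgren.integral_indicator_curl_lundgren_const_le_of_budget`). -/
theorem palasekTowerBreakdown_childCirculation_outside_le_of_budget_anyProfile (R : TowerRates)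
    (k : ℕ) {l : ℝ} (hl : 0 < l) (hS' : Convex ℝ S') (hv : IsClassicalNSSolutionOn S' 1 0 v q)
    (hω : HasUniformRapidDecayOn S' (fun σ η => PlanarEigenmode.vorticity (v σ) η))
    (hBS : ∀ σ ∈ S', ∀ η, v σ η = biotSavart2D (PlanarEigenmode.vorticity (v σ)) η)
    (hw : IsSmoothSpaceTimeOn S' w)
    (hmaps : MapsTo (fun t => (exp (l * R.A k * t) - 1) / (l * R.A k)) S S') (h0 : (0 : ℝ) ∈ S)
    {t : ℝ} (ht : t ∈ S) (ht0 : 0 ≤ t) (z₀ z : ℝ)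
    (hpos : ∀ x : EuclideanSpace ℝ (Fin 3), 0 ≤ curl (velocity (fun _ => l * R.A k)
          (fun t y => exp (l * R.A k * t / 2) •
            v ((exp (l * R.A k * t) - 1) / (l * R.A k)) (exp (l * R.A k * t / 2) • y))
          (fun t y => exp (-(l * R.A k * t)) •
            w ((exp (l * R.A k * t) - 1) / (l * R.A k)) (exp (l * R.A k * t / 2) • y)) 0) x 2)
    (hΓ : 0 < ∫ y : EuclideanSpace ℝ (Fin 2),
        curl (velocity (fun _ => l * R.A k)
          (fun t y => exp (l * R.A k * t / 2) •
            v ((exp (l * R.A k * t) - 1) / (l * R.A k)) (exp (l * R.A k * t / 2) • y))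
          (fun t y => exp (-(l * R.A k * t)) •
            w ((exp (l * R.A k * t) - 1) / (l * R.A k)) (exp (l * R.A k * t / 2) • y)) 0)
          (embedXY y + z₀ • eZ) 2)
    {ρ : ℝ} (hρ : 1 < ρ)
    (hfat : ρ * (1 / (l * R.A k)) < (∫ y : EuclideanSpace ℝ (Fin 2), ‖y‖ ^ 2 *
        curl (velocity (fun _ => l * R.A k)
          (fun t y => exp (l * R.A k * t / 2) •
            v ((exp (l * R.A k * t) - 1) / (l * R.A k)) (exp (l * R.A k * t / 2) • y))
          (fun t y => exp (-(l * R.A k * t)) •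
            w ((exp (l * R.A k * t) - 1) / (l * R.A k)) (exp (l * R.A k * t / 2) • y)) 0)
          (embedXY y + z₀ • eZ) 2) /
        (4 * ∫ y : EuclideanSpace ℝ (Fin 2),
          curl (velocity (fun _ => l * R.A k)
          (fun t y => exp (l * R.A k * t / 2) •
            v ((exp (l * R.A k * t) - 1) / (l * R.A k)) (exp (l * R.A k * t / 2) • y))
          (fun t y => exp (-(l * R.A k * t)) •
            w ((exp (l * R.A k * t) - 1) / (l * R.A k)) (exp (l * R.A k * t / 2) • y)) 0)
          (embedXY y + z₀ • eZ) 2))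
    (hbud : log (((∫ y : EuclideanSpace ℝ (Fin 2), ‖y‖ ^ 2 *
        curl (velocity (fun _ => l * R.A k)
          (fun t y => exp (l * R.A k * t / 2) •
            v ((exp (l * R.A k * t) - 1) / (l * R.A k)) (exp (l * R.A k * t / 2) • y))
          (fun t y => exp (-(l * R.A k * t)) •
            w ((exp (l * R.A k * t) - 1) / (l * R.A k)) (exp (l * R.A k * t / 2) • y)) 0)
          (embedXY y + z₀ • eZ) 2) /
        (4 * ∫ y : EuclideanSpace ℝ (Fin 2),
          curl (velocity (fun _ => l * R.A k)
          (fun t y => exp (l * R.A k * t / 2) •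
            v ((exp (l * R.A k * t) - 1) / (l * R.A k)) (exp (l * R.A k * t / 2) • y))
          (fun t y => exp (-(l * R.A k * t)) •
            w ((exp (l * R.A k * t) - 1) / (l * R.A k)) (exp (l * R.A k * t / 2) • y)) 0)
          (embedXY y + z₀ • eZ) 2) * (l * R.A k) - 1) / (ρ - 1)) ≤ l * R.A k * t)
    {r : ℝ} (hr : 0 < r) :
    ∫ y : EuclideanSpace ℝ (Fin 2), (Metric.closedBall (0 : EuclideanSpace ℝ (Fin 2)) r)ᶜ.indicator (fun y =>
        curl (velocity (fun _ => l * R.A k)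
          (fun t y => exp (l * R.A k * t / 2) •
            v ((exp (l * R.A k * t) - 1) / (l * R.A k)) (exp (l * R.A k * t / 2) • y))
          (fun t y => exp (-(l * R.A k * t)) •
            w ((exp (l * R.A k * t) - 1) / (l * R.A k)) (exp (l * R.A k * t / 2) • y)) t)
          (embedXY y + z • eZ) 2) y ≤
      4 * (∫ y : EuclideanSpace ℝ (Fin 2),
        curl (velocity (fun _ => l * R.A k)
          (fun t y => exp (l * R.A k * t / 2) •
            v ((exp (l * R.A k * t) - 1) / (l * R.A k)) (exp (l * R.A k * t / 2) • y))
          (fun t y => exp (-(l * R.A k * t)) •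
            w ((exp (l * R.A k * t) - 1) / (l * R.A k)) (exp (l * R.A k * t / 2) • y)) 0)
          (embedXY y + z₀ • eZ) 2) * ρ / (l * R.A k * r ^ 2) := by
  have hγ : 0 < l * R.A k := mul_pos hl (R.A_pos k)
  have h := integral_indicator_curl_lundgren_const_le_of_budget hγ one_pos hS' hv hω hBS hw hmaps h0
    ht ht0 z₀ z hpos hΓ hρ hfat (by rw [div_div_eq_mul_div, div_one]; exact hbud) hr
  simpa only [mul_one] using h

end Summit.NavierStokesRegularity.FluidComputer.PalasekTowerClayBridge
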